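import Mathlib
import HarnessLib

/-!
# The distance function: Fréchet subgradients and closest points (Borwein–Zhu 2005, §5.3.3)

Literature anchor transcribing J. M. Borwein and Q. J. Zhu, *Techniques of Variational Analysis*,
CMS Books in Mathematics 20, Springer (2005) [BorweinZhu2005], Chapter 5 "Variational Techniques
and Multifunctions", §5.3 "Distance Functions", §5.3.3 "Closest Points", pp. 208–209, together with
Exercises 5.3.2, 5.3.5 and 5.3.6 (pp. 210–211), for a closed subset `S` of a real inner product
space `H` and the distance function `d_S = Metric.infDist · S`.

* p. 208: `s ∈ S` is a **closest point** to `x` in `S` if `‖x - s‖ = d_S(x)` (`IsClosestPoint`).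
* Exercise 5.3.5 (v) (p. 211), taken here as the definition of the **proximal normal cone**:
  `x* ∈ N_P(S; x̄)` iff `x̄ ∈ S` and `⟪x*, s - x̄⟫ ≤ r ‖s - x̄‖²` on `S` for some `r > 0`
  (`IsProximalNormal`); Exercise 5.3.5: nonnegative multiples of `x - s̄`, `s̄` a closest point to
  `x`, are proximal normals (`IsClosestPoint.two_inner_le`, `IsClosestPoint.isProximalNormal_smul`),
  and `N_P(S; x̄) ⊆ N_F(S; x̄)` (`IsProximalNormal.isFrechetNormal`), where the **Fréchet normal
  cone** (Def 3.1.6, p. 41) and the **Fréchet subdifferential** (Def 3.1.1, p. 39) are written in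
  Riesz form, with `x* ∈ H` acting by `⟪x*, ·⟫` (`IsFrechetNormal`, `HasFSubgradientAt`).
* Exercise 5.3.2 (p. 210): `d_S²(y) - d_S²(x) = 2 d_S(x) (d_S(y) - d_S(x)) + (d_S(y) - d_S(x))²`
  (`sq_sub_sq_eq`), whence the one-sided estimate (5.3.1) for `d_S²` from a Fréchet subgradient of
  `d_S` (`HasFSubgradientAt.sq_lower`).
* **Theorem 5.3.4** (Subdifferential of the Distance Function and Closest Point, p. 208). Let `S`
  be closed, `x ∉ S` and `x* ∈ ∂_F d_S(x)`. With `x̄ := x - d_S(x) x*` ((5.3.4)):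
  (i) every minimizing sequence `(x_i) ⊆ S` of `inf {‖s - x‖ | s ∈ S}` converges to `x̄`
  (`HasFSubgradientAt.tendsto_of_minimizing`), so that `x̄ ∈ S` is the unique closest point of
  `x` in `S` (`HasFSubgradientAt.sub_smul_mem`, `.isClosestPoint`, `.eq_of_isClosestPoint`);
  (ii) `‖x*‖ = 1`, `d_S²` is Fréchet differentiable at `x` with derivative `2 d_S(x) x*`, `d_S` is
  Fréchet differentiable at `x` with `d_S'(x) = x* = (x - x̄)/‖x - x̄‖` (`.norm_eq_one`,
  `.hasFDerivAt_sq`, `.hasFDerivAt`, `.hasGradientAt`, `.eq_inv_norm_smul`);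
  (iii) `x* ∈ N_F(S; x̄)`, indeed (Exercise 5.3.6) `x* ∈ N_P(S; x̄)` (`.isProximalNormal`,
  `.isFrechetNormal`); assembled as printed in `exists_closestPoint_of_hasFSubgradientAt`.
  A minimizing sequence always exists (`exists_minimizing_seq`).

Deviations from the printed text, declared: (a) `H` is any real inner product space — the printed
Hilbert-space completeness is not used, because the limit `x̄` is given by the explicit formula
(5.3.4) (`hasGradientAt`, phrased with Mathlib's `HasGradientAt`, needs `CompleteSpace H` only
because Mathlib defines gradients through the Riesz isometry); (b) the dual space is identified with
`H` throughout (Riesz), so `∂_F d_S(x) ⊆ H` and the normal cones are subsets of `H`; (c) the proof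
of (i) runs the printed estimate (5.3.3) with the test points `y = x + t v`, `‖v‖ ≤ 1`, for one
fixed small `t > 0` instead of `t = ε_i` (which may vanish), and (ii) is obtained by squeezing
`d_S²` between the subgradient estimate (5.3.1) and `‖· - x̄‖²` ((5.3.5)) and then taking the
square root, instead of the printed uniform difference-quotient argument; (d) the proximal normal
cone is introduced through the inequality of Exercise 5.3.5 (v) rather than through proximal
subgradients of `ι_S`. Corollary 5.3.5 (density of points with closest points, which needs the
density of `dom ∂_F d_S` from Ch. 3) and Corollary 5.3.6 (closed convex sets are Chebyshev —
Mathlib's `exists_norm_eq_iInf_of_complete_convex`) are not transcribed.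

## Mathlib / tree status

Mathlib has `Metric.infDist` with `infDist_le_dist_of_mem`, `infDist_lt_iff`,
`IsClosed.notMem_iff_infDist_pos`, the convex projection theory
(`exists_norm_eq_iInf_of_complete_convex`, `norm_eq_iInf_iff_real_inner_le_zero`) and
`HasFDerivAt.sqrt`, but no statement on Fréchet subgradients of `infDist` or on closest points in
non-convex sets (`lean search` for "closest point", "proximal normal", `infDist` + `HasFDerivAt`:
no hits). In the tree, `Literature.Analysis.Convex.FrechetSubdifferential` records Def 3.1.1 /
Def 3.1.6 over a normed space with functionals `X →L[ℝ] ℝ` (`frechetSubdiff`,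
`frechetNormalCone`); the present `HasFSubgradientAt f x* x` and `IsFrechetNormal S x̄ x*` are
literally `innerSL ℝ x* ∈ frechetSubdiff f x` and `innerSL ℝ x* ∈ frechetNormalCone S x̄` of that
file (`mem_frechetSubdiff_iff_nhds`, `mem_frechetNormalCone_iff`), restated here in Riesz form so
that this file depends on Mathlib only. `ConvexMetricProjection` / `ChebyshevSetConvexity` treat
the convex and the Chebyshev case; nothing here is imported from or repeated in them.
-/

noncomputable section

open Set Filter Metric Topology
open scoped InnerProductSpace

namespace Literature.Analysis.Convex.DistanceFunctionClosestPoints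

variable {H : Type*} [NormedAddCommGroup H] [InnerProductSpace ℝ H]

/-! ## Definitions -/

/-- Fréchet subgradient in Riesz form: `x* ∈ ∂_F f(x)` iff
`liminf_{y → x} (f(y) - f(x) - ⟪x*, y - x⟫)/‖y - x‖ ≥ 0`, i.e. for every `ε > 0`,
`f(y) - f(x) - ⟪x*, y - x⟫ ≥ -ε ‖y - x‖` near `x`.
[cite: BorweinZhu2005, §3.1.1 Def 3.1.1 (3.1.1) p. 39] -/
def HasFSubgradientAt (f : H → ℝ) (xs x : H) : Prop :=
  ∀ ε : ℝ, 0 < ε → ∀ᶠ y in 𝓝 x, -(ε * ‖y - x‖) ≤ f y - f x - ⟪xs, y - x⟫_ℝ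

/-- Fréchet normal in Riesz form: `x* ∈ N_F(S; x) = ∂_F ι_S(x)`, i.e. `x ∈ S` and for every
`ε > 0`, `⟪x*, y - x⟫ ≤ ε ‖y - x‖` for `y ∈ S` near `x`.
[cite: BorweinZhu2005, §3.1.1 Def 3.1.6 p. 41] -/
def IsFrechetNormal (S : Set H) (x xs : H) : Prop :=
  x ∈ S ∧ ∀ ε : ℝ, 0 < ε → ∀ᶠ y in 𝓝 x, y ∈ S → ⟪xs, y - x⟫_ℝ ≤ ε * ‖y - x‖

/-- Proximal normal: `x* ∈ N_P(S; x)` iff `x ∈ S` and there exists `r > 0` with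
`⟪x*, s - x⟫ ≤ r ‖s - x‖²` for all `s ∈ S` (the characterisation of Exercise 5.3.5 (v), taken as
the definition). [cite: BorweinZhu2005, §5.3.4 Exercise 5.3.5 (v) p. 211] -/
def IsProximalNormal (S : Set H) (x xs : H) : Prop :=
  x ∈ S ∧ ∃ r : ℝ, 0 < r ∧ ∀ s ∈ S, ⟪xs, s - x⟫_ℝ ≤ r * ‖s - x‖ ^ 2

/-- `s ∈ S` is a closest point to `x` in `S` provided `‖x - s‖ = d_S(x)`.
[cite: BorweinZhu2005, §5.3.3 p. 208] -/
def IsClosestPoint (S : Set H) (x s : H) : Prop :=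
  s ∈ S ∧ ‖x - s‖ = infDist x S

variable {S : Set H} {x xs z : H}

/-! ## Exercises 5.3.2 and 5.3.5: the identity and proximal normals at closest points -/

/-- Exercise 5.3.2: `d_S²(y) - d_S²(x) = 2 d_S(x)(d_S(y) - d_S(x)) + (d_S(y) - d_S(x))²`.
[cite: BorweinZhu2005, §5.3.4 Exercise 5.3.2 p. 210] -/
theorem sq_sub_sq_eq (a b : ℝ) : a ^ 2 - b ^ 2 = 2 * b * (a - b) + (a - b) ^ 2 := by
  ring

/-- If `s̄` is a closest point to `x` in `S` then `2 ⟪x - s̄, s - s̄⟫ ≤ ‖s - s̄‖²` for all `s ∈ S`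
(expand `‖x - s̄‖² ≤ ‖x - s‖²`). [cite: BorweinZhu2005, §5.3.4 Exercise 5.3.5 p. 210] -/
theorem IsClosestPoint.two_inner_le (h : IsClosestPoint S x z) {s : H} (hs : s ∈ S) :
    2 * ⟪x - z, s - z⟫_ℝ ≤ ‖s - z‖ ^ 2 := by
  have h1 : ‖x - z‖ ≤ ‖x - s‖ := by
    rw [h.2, ← dist_eq_norm]
    exact infDist_le_dist_of_mem hs
  have h2 : ‖x - z‖ ^ 2 ≤ ‖x - s‖ ^ 2 := pow_le_pow_left₀ (norm_nonneg _) h1 2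
  have h3 : x - s = (x - z) - (s - z) := by abel
  have h4 := norm_sub_sq_real (x - z) (s - z)
  rw [← h3] at h4
  linarith

/-- Exercise 5.3.5: if `s̄` is a closest point to `x ∉ S` in `S`, every nonnegative multiple of
`x - s̄` is a proximal normal vector to `S` at `s̄`.
[cite: BorweinZhu2005, §5.3.4 Exercise 5.3.5 p. 210] -/
theorem IsClosestPoint.isProximalNormal_smul (h : IsClosestPoint S x z) {t : ℝ} (ht : 0 ≤ t) :
    IsProximalNormal S z (t • (x - z)) := by
  refine ⟨h.1, (t + 1) / 2, by positivity, fun s hs => ?_⟩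
  rw [real_inner_smul_left]
  have h1 := h.two_inner_le hs
  nlinarith [sq_nonneg ‖s - z‖, mul_le_mul_of_nonneg_left h1 ht]

/-- Exercise 5.3.5, conclusion: `N_P(S; x̄) ⊆ N_F(S; x̄)`.
[cite: BorweinZhu2005, §5.3.4 Exercise 5.3.5 (v) p. 211] -/
theorem IsProximalNormal.isFrechetNormal (h : IsProximalNormal S x xs) :
    IsFrechetNormal S x xs := by
  obtain ⟨hx, r, hr, hrS⟩ := h
  refine ⟨hx, fun ε hε => ?_⟩
  filter_upwards [ball_mem_nhds x (div_pos hε hr)] with y hy hyS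
  rw [mem_ball, dist_eq_norm] at hy
  have h1 : r * ‖y - x‖ ≤ ε := by
    have := (lt_div_iff₀ hr).1 hy
    linarith [mul_comm r ‖y - x‖]
  calc ⟪xs, y - x⟫_ℝ ≤ r * ‖y - x‖ ^ 2 := hrS y hyS
    _ = (r * ‖y - x‖) * ‖y - x‖ := by ring
    _ ≤ ε * ‖y - x‖ := mul_le_mul_of_nonneg_right h1 (norm_nonneg _)

/-- A minimizing sequence of `inf {‖s - x‖ | s ∈ S}` in a nonempty `S` always exists. [folklore] -/
private theorem exists_minimizing_seq_aux {E : Type*} [NormedAddCommGroup E] {S : Set E}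
    (hne : S.Nonempty) (x : E) :
    ∃ s : ℕ → E, (∀ n, s n ∈ S) ∧ ∀ n, ‖s n - x‖ < infDist x S + 1 / ((n : ℝ) + 1) := by
  have h : ∀ n : ℕ, ∃ y ∈ S, dist x y < infDist x S + 1 / ((n : ℝ) + 1) := fun n =>
    (infDist_lt_iff hne).1 (by
      have : (0 : ℝ) < 1 / ((n : ℝ) + 1) := by positivity
      linarith)
  choose s hsS hs using h
  refine ⟨s, hsS, fun n => ?_⟩
  rw [← dist_eq_norm, dist_comm]
  exact hs n

/-- A minimizing sequence `(x_i) ⊆ S` of `inf {‖s - x‖ | s ∈ S} = d_S(x)` exists whenever `S` is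
nonempty. [cite: BorweinZhu2005, §5.3.3 Thm 5.3.4 (i) p. 208] -/
theorem exists_minimizing_seq {E : Type*} [NormedAddCommGroup E] {S : Set E} (hne : S.Nonempty)
    (x : E) :
    ∃ s : ℕ → E, (∀ n, s n ∈ S) ∧ Tendsto (fun n => ‖s n - x‖) atTop (𝓝 (infDist x S)) := by
  obtain ⟨s, hsS, hs⟩ := exists_minimizing_seq_aux hne x
  refine ⟨s, hsS, ?_⟩
  have h0 : Tendsto (fun n : ℕ => infDist x S + 1 / ((n : ℝ) + 1)) atTop (𝓝 (infDist x S)) := by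
    simpa using tendsto_const_nhds.add (tendsto_one_div_add_atTop_nhds_zero_nat (𝕜 := ℝ))
  refine tendsto_of_tendsto_of_tendsto_of_le_of_le tendsto_const_nhds h0 (fun n => ?_)
    (fun n => (hs n).le)
  rw [← dist_eq_norm, dist_comm]
  exact infDist_le_dist_of_mem (hsS n)

/-! ## Theorem 5.3.4 -/

/-- (5.3.1): a Fréchet subgradient `x*` of `d_S` at `x` gives, by Exercise 5.3.2,
`d_S²(y) - d_S²(x) ≥ 2 d_S(x) (⟪x*, y - x⟫ - ε ‖y - x‖)` near `x`, i.e.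
`2 d_S(x) x* ∈ ∂_F d_S²(x)`. [cite: BorweinZhu2005, §5.3.3 Thm 5.3.4 proof, (5.3.1) p. 208] -/
theorem HasFSubgradientAt.sq_lower (hsub : HasFSubgradientAt (fun y => infDist y S) xs x)
    {ε : ℝ} (hε : 0 < ε) :
    ∀ᶠ y in 𝓝 x, 2 * infDist x S * (⟪xs, y - x⟫_ℝ - ε * ‖y - x‖) ≤
      infDist y S ^ 2 - infDist x S ^ 2 := by
  filter_upwards [hsub ε hε] with y hy
  have hd : 0 ≤ infDist x S := infDist_nonneg
  have h1 : ⟪xs, y - x⟫_ℝ - ε * ‖y - x‖ ≤ infDist y S - infDist x S := by linarith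
  rw [sq_sub_sq_eq]
  nlinarith [sq_nonneg (infDist y S - infDist x S), mul_le_mul_of_nonneg_left h1 hd]

/-- From (5.3.1): `2 d_S(x) x* ∈ ∂_F d_S²(x)` ("and therefore `2 d_S(x) x* ∈ ∂_F d_S²(x)`").
[cite: BorweinZhu2005, §5.3.3 Thm 5.3.4 proof p. 208; §5.3.4 Exercise 5.3.3 p. 210] -/
theorem HasFSubgradientAt.sq (hsub : HasFSubgradientAt (fun y => infDist y S) xs x) :
    HasFSubgradientAt (fun y => infDist y S ^ 2) ((2 * infDist x S) • xs) x := by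
  intro ε hε
  by_cases hd : infDist x S = 0
  · refine Eventually.of_forall fun y => ?_
    rw [hd, mul_zero, zero_smul, inner_zero_left, sub_zero]
    nlinarith [sq_nonneg (infDist y S), norm_nonneg (y - x), hε.le]
  · have hd' : 0 < infDist x S := lt_of_le_of_ne infDist_nonneg (Ne.symm hd)
    filter_upwards [hsub.sq_lower (show 0 < ε / (2 * infDist x S) by positivity)] with y hy
    rw [real_inner_smul_left]
    have h1 : 2 * infDist x S * (ε / (2 * infDist x S) * ‖y - x‖) = ε * ‖y - x‖ := by
      field_simp
    nlinarith [hy, h1]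

/-- **Theorem 5.3.4 (i)**, convergence: if `S` is closed, `x ∉ S` and `x* ∈ ∂_F d_S(x)`, then
every minimizing sequence `(x_i) ⊆ S` of `inf {‖s - x‖ | s ∈ S}` converges to
`x̄ = x - d_S(x) x*` ((5.3.3)–(5.3.4)). [cite: BorweinZhu2005, §5.3.3 Thm 5.3.4 (i) pp. 208–209] -/
theorem HasFSubgradientAt.tendsto_of_minimizing (hS : IsClosed S) (hx : x ∉ S)
    (hsub : HasFSubgradientAt (fun y => infDist y S) xs x) {s : ℕ → H} (hsS : ∀ n, s n ∈ S)
    (hmin : Tendsto (fun n => ‖s n - x‖) atTop (𝓝 (infDist x S))) :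
    Tendsto s atTop (𝓝 (x - infDist x S • xs)) := by
  have hne : S.Nonempty := ⟨s 0, hsS 0⟩
  set d := infDist x S with hd_def
  have hd : 0 < d := (hS.notMem_iff_infDist_pos hne).1 hx
  rw [Metric.tendsto_atTop]
  intro η hη
  obtain ⟨δ, hδ, hball⟩ : ∃ δ > 0, ∀ ⦃y : H⦄, dist y x < δ →
      2 * d * (⟪xs, y - x⟫_ℝ - η / (6 * d) * ‖y - x‖) ≤ infDist y S ^ 2 - d ^ 2 :=
    Metric.eventually_nhds_iff.1 (hsub.sq_lower (show 0 < η / (6 * d) by positivity))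
  set t := min (δ / 2) (η / 3) with ht_def
  have ht : 0 < t := by positivity
  have htδ : t < δ := by
    have := min_le_left (δ / 2) (η / 3)
    linarith
  have htη : t ≤ η / 3 := min_le_right _ _
  have he : Tendsto (fun n => ‖s n - x‖ ^ 2 - d ^ 2) atTop (𝓝 0) := by
    have := (hmin.pow 2).sub_const (d ^ 2)
    simpa using this
  obtain ⟨N, hN⟩ := (Metric.tendsto_atTop.1 he) (t * (η / 3)) (by positivity)
  refine ⟨N, fun n hn => ?_⟩
  have hen : ‖s n - x‖ ^ 2 - d ^ 2 < t * (η / 3) := by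
    have := hN n hn
    rw [dist_zero_right, Real.norm_eq_abs] at this
    exact (le_abs_self _).trans_lt this
  set w := s n - x + d • xs with hw_def
  have key : ∀ v : H, ‖v‖ ≤ 1 → 2 * ⟪v, w⟫_ℝ ≤ t + η / 3 + η / 3 := by
    intro v hv
    have hv0 := norm_nonneg v
    have hy : dist (x + t • v) x < δ := by
      rw [dist_eq_norm, add_sub_cancel_left, norm_smul, Real.norm_eq_abs, abs_of_pos ht]
      nlinarith
    have h1 := hball hy
    rw [add_sub_cancel_left, inner_smul_right, norm_smul, Real.norm_eq_abs, abs_of_pos ht] at h1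
    have h2 : infDist (x + t • v) S ≤ ‖x + t • v - s n‖ := by
      rw [← dist_eq_norm]
      exact infDist_le_dist_of_mem (hsS n)
    have h3 : infDist (x + t • v) S ^ 2 ≤ ‖x + t • v - s n‖ ^ 2 :=
      pow_le_pow_left₀ infDist_nonneg h2 2
    have h4 : ‖x + t • v - s n‖ ^ 2 =
        t ^ 2 * ‖v‖ ^ 2 - 2 * t * ⟪v, s n - x⟫_ℝ + ‖s n - x‖ ^ 2 := by
      have : x + t • v - s n = t • v - (s n - x) := by abel
      rw [this, norm_sub_sq_real, norm_smul, real_inner_smul_left, Real.norm_eq_abs,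
        abs_of_pos ht]
      ring
    have h5 : 2 * d * (t * ⟪xs, v⟫_ℝ - η / (6 * d) * (t * ‖v‖)) =
        2 * d * t * ⟪xs, v⟫_ℝ - η / 3 * t * ‖v‖ := by
      field_simp
      ring
    have h6 : ⟪v, w⟫_ℝ = ⟪v, s n - x⟫_ℝ + d * ⟪xs, v⟫_ℝ := by
      rw [hw_def, inner_add_right, inner_smul_right, real_inner_comm xs v]
    have h7 : t * (2 * ⟪v, w⟫_ℝ) ≤
        t * (t * ‖v‖ ^ 2) + (‖s n - x‖ ^ 2 - d ^ 2) + t * (η / 3 * ‖v‖) := by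
      rw [h6]
      nlinarith [h1, h3, h4, h5]
    have hv2 : ‖v‖ ^ 2 ≤ 1 := pow_le_one₀ hv0 hv
    have h8 : t * (t * ‖v‖ ^ 2) ≤ t * t := by
      apply mul_le_mul_of_nonneg_left _ ht.le
      nlinarith
    have h9 : t * (η / 3 * ‖v‖) ≤ t * (η / 3) := by
      apply mul_le_mul_of_nonneg_left _ ht.le
      nlinarith
    have h10 : t * (2 * ⟪v, w⟫_ℝ) ≤ t * (t + η / 3 + η / 3) := by nlinarith
    exact le_of_mul_le_mul_left h10 ht
  rw [dist_eq_norm]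
  have hsn : s n - (x - d • xs) = w := by
    rw [hw_def]
    abel
  rw [hsn]
  by_cases hw : w = 0
  · rw [hw, norm_zero]
    exact hη
  · have hwpos : 0 < ‖w‖ := norm_pos_iff.2 hw
    have h11 := key (‖w‖⁻¹ • w)
      (le_of_eq (by rw [norm_smul, norm_inv, norm_norm, inv_mul_cancel₀ hwpos.ne']))
    rw [real_inner_smul_left, real_inner_self_eq_norm_sq] at h11
    have h12 : ‖w‖⁻¹ * ‖w‖ ^ 2 = ‖w‖ := by
      field_simp
    rw [h12] at h11
    linarith

/-- **Theorem 5.3.4 (i)**, existence: `x̄ = x - d_S(x) x*` lies in `S`.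
[cite: BorweinZhu2005, §5.3.3 Thm 5.3.4 (i), (5.3.4) p. 209] -/
theorem HasFSubgradientAt.sub_smul_mem (hS : IsClosed S) (hne : S.Nonempty) (hx : x ∉ S)
    (hsub : HasFSubgradientAt (fun y => infDist y S) xs x) : x - infDist x S • xs ∈ S := by
  obtain ⟨s, hsS, hmin⟩ := exists_minimizing_seq hne x
  exact hS.mem_of_tendsto (hsub.tendsto_of_minimizing hS hx hsS hmin) (Eventually.of_forall hsS)

/-- **Theorem 5.3.4 (i)**: `‖x - x̄‖ = d_S(x)` for `x̄ = x - d_S(x) x*`.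
[cite: BorweinZhu2005, §5.3.3 Thm 5.3.4 (i) p. 209] -/
theorem HasFSubgradientAt.norm_sub_eq_infDist (hS : IsClosed S) (hne : S.Nonempty) (hx : x ∉ S)
    (hsub : HasFSubgradientAt (fun y => infDist y S) xs x) :
    ‖x - (x - infDist x S • xs)‖ = infDist x S := by
  obtain ⟨s, hsS, hmin⟩ := exists_minimizing_seq hne x
  have h1 := hsub.tendsto_of_minimizing hS hx hsS hmin
  have h2 : Tendsto (fun n => ‖s n - x‖) atTop (𝓝 ‖(x - infDist x S • xs) - x‖) :=
    (h1.sub_const x).norm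
  rw [← norm_sub_rev]
  exact tendsto_nhds_unique h2 hmin

/-- **Theorem 5.3.4 (i)**: `x̄ = x - d_S(x) x*` is a closest point of `x` in `S`.
[cite: BorweinZhu2005, §5.3.3 Thm 5.3.4 (i) p. 209] -/
theorem HasFSubgradientAt.isClosestPoint (hS : IsClosed S) (hne : S.Nonempty) (hx : x ∉ S)
    (hsub : HasFSubgradientAt (fun y => infDist y S) xs x) :
    IsClosestPoint S x (x - infDist x S • xs) :=
  ⟨hsub.sub_smul_mem hS hne hx, hsub.norm_sub_eq_infDist hS hne hx⟩

/-- **Theorem 5.3.4 (i)**, uniqueness: every closest point of `x` in `S` equals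
`x̄ = x - d_S(x) x*` (apply the convergence statement to a constant sequence).
[cite: BorweinZhu2005, §5.3.3 Thm 5.3.4 (i) p. 209] -/
theorem HasFSubgradientAt.eq_of_isClosestPoint (hS : IsClosed S) (hx : x ∉ S)
    (hsub : HasFSubgradientAt (fun y => infDist y S) xs x) (hz : IsClosestPoint S x z) :
    z = x - infDist x S • xs := by
  have h1 : Tendsto (fun _ : ℕ => ‖z - x‖) atTop (𝓝 (infDist x S)) := by
    rw [norm_sub_rev, hz.2]
    exact tendsto_const_nhds
  exact tendsto_nhds_unique tendsto_const_nhds (hsub.tendsto_of_minimizing hS hx (fun _ => hz.1) h1)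

/-- **Theorem 5.3.4 (ii)**: a Fréchet subgradient of `d_S` at a point outside the closed set `S`
is a unit vector. [cite: BorweinZhu2005, §5.3.3 Thm 5.3.4 (ii) p. 209] -/
theorem HasFSubgradientAt.norm_eq_one (hS : IsClosed S) (hne : S.Nonempty) (hx : x ∉ S)
    (hsub : HasFSubgradientAt (fun y => infDist y S) xs x) : ‖xs‖ = 1 := by
  have hd : 0 < infDist x S := (hS.notMem_iff_infDist_pos hne).1 hx
  have h := hsub.norm_sub_eq_infDist hS hne hx
  rw [sub_sub_cancel, norm_smul, Real.norm_eq_abs, abs_of_pos hd] at h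
  exact mul_left_cancel₀ hd.ne' (h.trans (mul_one _).symm)

/-- **Theorem 5.3.4 (ii)**: `x* = (x - x̄)/‖x - x̄‖`.
[cite: BorweinZhu2005, §5.3.3 Thm 5.3.4 (ii) p. 209] -/
theorem HasFSubgradientAt.eq_inv_norm_smul (hS : IsClosed S) (hne : S.Nonempty) (hx : x ∉ S)
    (hsub : HasFSubgradientAt (fun y => infDist y S) xs x) :
    xs = ‖x - (x - infDist x S • xs)‖⁻¹ • (x - (x - infDist x S • xs)) := by
  have hd : 0 < infDist x S := (hS.notMem_iff_infDist_pos hne).1 hx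
  rw [hsub.norm_sub_eq_infDist hS hne hx, sub_sub_cancel, smul_smul, inv_mul_cancel₀ hd.ne',
    one_smul]

/-- **Theorem 5.3.4 (ii)**, squared form ((5.3.1) and (5.3.5)): `d_S²` is Fréchet differentiable
at `x` with `(d_S²)'(x) = 2 d_S(x) x*`.
[cite: BorweinZhu2005, §5.3.3 Thm 5.3.4 (ii), (5.3.5) p. 209] -/
theorem HasFSubgradientAt.hasFDerivAt_sq (hS : IsClosed S) (hne : S.Nonempty) (hx : x ∉ S)
    (hsub : HasFSubgradientAt (fun y => infDist y S) xs x) :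
    HasFDerivAt (fun y => infDist y S ^ 2) ((2 * infDist x S) • innerSL ℝ xs) x := by
  set d := infDist x S with hd_def
  have hd : 0 < d := (hS.notMem_iff_infDist_pos hne).1 hx
  have hmem := hsub.sub_smul_mem hS hne hx
  have hn1 := hsub.norm_eq_one hS hne hx
  rw [hasFDerivAt_iff_isLittleO, Asymptotics.isLittleO_iff]
  intro c hc
  have hlow := hsub.sq_lower (show 0 < c / (2 * d) by positivity)
  have hup : ∀ᶠ y in 𝓝 x, ‖y - x‖ ≤ c := by
    filter_upwards [closedBall_mem_nhds x hc] with y hy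
    rwa [mem_closedBall, dist_eq_norm] at hy
  filter_upwards [hlow, hup] with y hy1 hy2
  simp only [FunLike.coe_smul, Pi.smul_apply, innerSL_apply_apply, smul_eq_mul,
    Real.norm_eq_abs]
  rw [abs_le]
  constructor
  · have h1 : 2 * d * (c / (2 * d) * ‖y - x‖) = c * ‖y - x‖ := by
      field_simp
    nlinarith [hy1, h1]
  · have h1 : infDist y S ≤ ‖y - (x - d • xs)‖ := by
      rw [← dist_eq_norm]
      exact infDist_le_dist_of_mem hmem
    have h2 : infDist y S ^ 2 ≤ ‖y - (x - d • xs)‖ ^ 2 := pow_le_pow_left₀ infDist_nonneg h1 2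
    have h3 : ‖y - (x - d • xs)‖ ^ 2 = ‖y - x‖ ^ 2 + 2 * d * ⟪xs, y - x⟫_ℝ + d ^ 2 := by
      have : y - (x - d • xs) = (y - x) + d • xs := by abel
      rw [this, norm_add_sq_real, inner_smul_right, norm_smul, Real.norm_eq_abs, abs_of_pos hd,
        hn1, real_inner_comm (y - x) xs]
      ring
    nlinarith [h2, h3, hy2, norm_nonneg (y - x)]

/-- **Theorem 5.3.4 (ii)**: `d_S` is Fréchet differentiable at `x` and `d_S'(x) = x*`.
[cite: BorweinZhu2005, §5.3.3 Thm 5.3.4 (ii) p. 209] -/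
theorem HasFSubgradientAt.hasFDerivAt (hS : IsClosed S) (hne : S.Nonempty) (hx : x ∉ S)
    (hsub : HasFSubgradientAt (fun y => infDist y S) xs x) :
    HasFDerivAt (fun y => infDist y S) (innerSL ℝ xs) x := by
  have hd : 0 < infDist x S := (hS.notMem_iff_infDist_pos hne).1 hx
  have h1 := (hsub.hasFDerivAt_sq hS hne hx).sqrt (by positivity)
  have h2 : (fun y => √(infDist y S ^ 2)) = fun y => infDist y S :=
    funext fun y => Real.sqrt_sq infDist_nonneg
  rw [h2, Real.sqrt_sq infDist_nonneg, smul_smul] at h1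
  have h3 : 1 / (2 * infDist x S) * (2 * infDist x S) = 1 := by
    field_simp
  rwa [h3, one_smul] at h1

/-- **Theorem 5.3.4 (ii)** with Mathlib's gradient: `∇ d_S(x) = x*` (in a Hilbert space, where
Mathlib's `HasGradientAt` is available). [cite: BorweinZhu2005, §5.3.3 Thm 5.3.4 (ii) p. 209] -/
theorem HasFSubgradientAt.hasGradientAt [CompleteSpace H] (hS : IsClosed S) (hne : S.Nonempty)
    (hx : x ∉ S) (hsub : HasFSubgradientAt (fun y => infDist y S) xs x) :
    HasGradientAt (fun y => infDist y S) xs x := by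
  rw [hasGradientAt_iff_hasFDerivAt]
  refine (hsub.hasFDerivAt hS hne hx).congr_fderiv ?_
  ext v
  simp [innerSL_apply_apply, InnerProductSpace.toDual_apply_apply]

/-- **Theorem 5.3.4 (iii)**, strengthened as in Exercise 5.3.6: `x* ∈ N_P(S; x̄)`.
[cite: BorweinZhu2005, §5.3.3 Thm 5.3.4 (iii) p. 209; §5.3.4 Exercise 5.3.6 p. 211] -/
theorem HasFSubgradientAt.isProximalNormal (hS : IsClosed S) (hne : S.Nonempty) (hx : x ∉ S)
    (hsub : HasFSubgradientAt (fun y => infDist y S) xs x) :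
    IsProximalNormal S (x - infDist x S • xs) xs := by
  have hd : 0 < infDist x S := (hS.notMem_iff_infDist_pos hne).1 hx
  have h := (hsub.isClosestPoint hS hne hx).isProximalNormal_smul (inv_nonneg.2 hd.le)
  rwa [sub_sub_cancel, smul_smul, inv_mul_cancel₀ hd.ne', one_smul] at h

/-- **Theorem 5.3.4 (iii)**: `x* ∈ N_F(S; x̄)`.
[cite: BorweinZhu2005, §5.3.3 Thm 5.3.4 (iii) p. 209] -/
theorem HasFSubgradientAt.isFrechetNormal (hS : IsClosed S) (hne : S.Nonempty) (hx : x ∉ S)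
    (hsub : HasFSubgradientAt (fun y => infDist y S) xs x) :
    IsFrechetNormal S (x - infDist x S • xs) xs :=
  (hsub.isProximalNormal hS hne hx).isFrechetNormal

/-- **Theorem 5.3.4** (Subdifferential of the Distance Function and Closest Point), assembled as
printed: for `S` closed, `x ∉ S` and `x* ∈ ∂_F d_S(x)` there is `x̄ ∈ S` such that (i) every
minimizing sequence in `S` of `inf {‖s - x‖ | s ∈ S}` converges to `x̄`, so that `x̄` is the unique
closest point of `x` in `S`; (ii) `d_S` is Fréchet differentiable at `x` with
`d_S'(x) = x* = (x - x̄)/‖x - x̄‖`; (iii) `x* ∈ N_F(S; x̄)`.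
[cite: BorweinZhu2005, §5.3.3 Thm 5.3.4 pp. 208–209] -/
theorem exists_closestPoint_of_hasFSubgradientAt (hS : IsClosed S) (hne : S.Nonempty)
    (hx : x ∉ S) (hsub : HasFSubgradientAt (fun y => infDist y S) xs x) :
    ∃ xbar ∈ S,
      (∀ s : ℕ → H, (∀ n, s n ∈ S) → Tendsto (fun n => ‖s n - x‖) atTop (𝓝 (infDist x S)) →
        Tendsto s atTop (𝓝 xbar)) ∧
      IsClosestPoint S x xbar ∧ (∀ z, IsClosestPoint S x z → z = xbar) ∧
      HasFDerivAt (fun y => infDist y S) (innerSL ℝ xs) x ∧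
      xs = ‖x - xbar‖⁻¹ • (x - xbar) ∧ IsFrechetNormal S xbar xs :=
  ⟨x - infDist x S • xs, hsub.sub_smul_mem hS hne hx,
    fun _ hsS hmin => hsub.tendsto_of_minimizing hS hx hsS hmin, hsub.isClosestPoint hS hne hx,
    fun _ hz => hsub.eq_of_isClosestPoint hS hx hz, hsub.hasFDerivAt hS hne hx,
    hsub.eq_inv_norm_smul hS hne hx, hsub.isFrechetNormal hS hne hx⟩

end Literature.Analysis.Convex.DistanceFunctionClosestPoints
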